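import Summits.NavierStokesRegularity.OSWSelfSimilar.SheetRPerturbedResolventIdentity
import Summits.NavierStokesRegularity.OSWSelfSimilar.SheetRPerturbedResolventBounds
import Summits.NavierStokesRegularity.OSWSelfSimilar.SheetRPerturbedResolventIdentityC
import Literature.Analysis.OperatorTheory.PseudoResolventTaylor
import Literature.Analysis.OperatorTheory.PseudoResolventFarField
import HarnessLib

/-!
# SHEET-ℝ: (P7) of the Z3-SR-SPEC spectral certificate INSTANTIATED — Taylor model and far field of
# `σ ↦ ⟪h, R_K(σ) f⟫_w` for the perturbed resolvent `R_K(σ) = resolventK` of the linearised sheet operator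

HONEST FRAMING (cell ns-blowup GROUP B / zone Z3, case Z3-SR-SPEC, paper item (P7); 1-D MODEL certificate frame (viscous gCLM/OSW
sheet on the line); not Euler/NS; «violates: none — MODEL»). Nothing here asserts that a profile exists; the Gårding datum
`GardingDataK` of the perturbed form (cert-1: `K = −P + F`, `m = c₁ + γ`) is the HYPOTHESIS, as in selfsim's resolvent files.

CONTENT: the abstract pseudo-resolvent lemmas of `Literature.Analysis.OperatorTheory.PseudoResolventTaylor` /
`…PseudoResolventFarField` (Kato I-§5.2) composed with selfsim's `isPseudoResolventK` (first resolvent identity on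
`{Re σ > −m}`) and `norm_resolventK_le_inv` (`‖R_K(σ)G‖_w ≤ ‖G‖_w/(m + Re σ)` = cert-1's `1/c_w(σ)`), in the complex pivot
`Wc L = L²_w(ℂ)` whose inner product is the `w`-pairing of record:
* `evans_taylor_remainder` — for `Re σ, Re(σ + ε) > −m` and any `p`:
  `‖⟪h, R_K(σ+ε) f⟫ − Σ_{j<p} (−ε)^j ⟪h, R_K(σ)^{j+1} f⟫‖ ≤ |ε|^p · ‖(R_K(σ)†)^p h‖ · ‖f‖ / (m + Re(σ+ε))`
  — PRICE-impl1 (S2)(b)'s step remainder `θ|ε|^p‖y_p‖_w‖h‖_w/c_w(σ+ε)` with the adjoint chain `y_p = (R_K(σ)†)^p h`;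
* `evans_farField_remainder` — for a chain `f_j = R_K(z)(f_{j+1} + z f_j)` («`f_{j+1} = A f_j`», e.g. cert-1's `a_j`):
  `‖⟪h, R_K(σ) f₀⟫ − Σ_{j<n} (−1)^j σ^{−(j+1)}⟪h, f_j⟫‖ ≤ |σ|^{−n}‖h‖‖f_n‖/(m + Re σ)` — (S2)(a)'s `θ‖h‖‖a₃‖/(c_w|σ|³)` at `n = 3`.
(`…C` twins: the same on `GardingDataKC` / `resolventKC`, general coefficient `c`.) What stays PAPER/Arb: the ball values of the coefficients and norms, and cert-1's identification of its Galerkin objects with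
`R_K`. KERNEL CAVEAT inherited from selfsim: tests are odd, `R_K` is THE resolvent on the odd class. WHAT THIS IS NOT: not NS;
no number of any certificate moves. [folklore] bookkeeping; the analysis is in the cited files.
-/

noncomputable section

namespace Summit.NavierStokesRegularity.OSWSelfSimilar
namespace SheetREvansTaylorModel

open _root_.MeasureTheory SheetRWeightedMeasure SheetREnergySpace SheetRComplexPivot SheetRPerturbedPair
  SheetRPerturbedResolvent SheetRPerturbedResolventIdentity SheetRPerturbedResolventBounds Literature.Analysis.OperatorTheory
open scoped InnerProductSpace

variable {L D₀ D₁ V₀ m : ℝ} {d V : ℝ → ℝ}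

/-- **(P7), step along the contour.** For the perturbed resolvent `R_K = resolventK` under a Gårding datum (`Re σ > −m`,
`Re(σ + ε) > −m`), every order `p` and all `h, f ∈ L²_w(ℂ)`:
`‖⟪h, R_K(σ+ε)f⟫ − Σ_{j<p} (−ε)^j⟪h, R_K(σ)^{j+1}f⟫‖ ≤ |ε|^p·‖(R_K(σ)†)^p h‖·‖f‖/(m + Re(σ+ε))`
(`IsPseudoResolvent.norm_inner_apply_sub_sum_le_of_bound` with `z = σ`, `w = σ + ε`, `c = m + Re(σ+ε)`). MODEL statement;
not NS. [folklore] -/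
theorem evans_taylor_remainder (hL : 0 < L) (K : Esp L hL →L[ℝ] W L) (h : GardingDataK L hL d V K D₀ D₁ V₀ m)
    {σ ε : ℂ} (hσ : -m < σ.re) (hσε : -m < (σ + ε).re) (p : ℕ) (hv f : Wc L) :
    ‖⟪hv, resolventK hL K h (σ + ε) f⟫_ℂ
        - ∑ j ∈ Finset.range p, (-ε) ^ j * ⟪hv, (resolventK hL K h σ ^ (j + 1)) f⟫_ℂ‖ ≤
      ‖ε‖ ^ p * ‖((ContinuousLinearMap.adjoint (resolventK hL K h σ)) ^ p) hv‖ * ‖f‖ / (m + (σ + ε).re) := by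
  have hJ := isPseudoResolventK hL K h
  have key := hJ.norm_inner_apply_sub_sum_le_of_bound (z := σ) (w := σ + ε) hσ hσε p hv f
    (c := m + (σ + ε).re) (fun G => norm_resolventK_le_inv hL K h hσε G)
  have e : σ - (σ + ε) = -ε := by ring
  rw [e, norm_neg] at key
  exact key

/-- **(P7), far field.** For the perturbed resolvent `R_K = resolventK` under a Gårding datum, a point `z` with `Re z > −m`,
a chain `f₀, …, f_n ∈ L²_w(ℂ)` with `f_j = R_K(z)(f_{j+1} + z f_j)` for `j < n` («`f_{j+1} = A f_j`»), and `σ ≠ 0` with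
`Re σ > −m`: `‖⟪h, R_K(σ)f₀⟫ − Σ_{j<n} (−1)^j σ^{−(j+1)}⟪h, f_j⟫‖ ≤ |σ|^{−n}·‖h‖·‖f_n‖/(m + Re σ)`
(`IsPseudoResolvent.norm_inner_apply_sub_sum_le_farField_of_bound`). MODEL statement; not NS. [folklore] -/
theorem evans_farField_remainder (hL : 0 < L) (K : Esp L hL →L[ℝ] W L) (h : GardingDataK L hL d V K D₀ D₁ V₀ m)
    {z σ : ℂ} (hz : -m < z.re) (hσ : -m < σ.re) (hσ0 : σ ≠ 0) {n : ℕ} {f : ℕ → Wc L}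
    (hchain : ∀ j < n, f j = resolventK hL K h z (f (j + 1) + z • f j)) (hv : Wc L) :
    ‖⟪hv, resolventK hL K h σ (f 0)⟫_ℂ
        - ∑ j ∈ Finset.range n, ((-1) ^ j * σ⁻¹ ^ (j + 1)) * ⟪hv, f j⟫_ℂ‖ ≤
      ‖σ‖⁻¹ ^ n * ‖hv‖ * ‖f n‖ / (m + σ.re) :=
  (isPseudoResolventK hL K h).norm_inner_apply_sub_sum_le_farField_of_bound hz hσ hσ0 hchain hv
    (fun G => norm_resolventK_le_inv hL K h hσ G)

/-! ### The same two statements on the general-coefficient datum `GardingDataKC` (cert-1's (S1) with `c = c₂ = 1/5`) -/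

section KC

open SheetRPerturbedResolventC SheetRPerturbedResolventIdentityC

variable {c : ℝ}

/-- **(P7), step along the contour, `GardingDataKC` version** (general `‖δ′‖²_w`-coefficient `c > 0`, the structure the (S1)
sentence of record inhabits verbatim): same statement as `evans_taylor_remainder` for `R_K = resolventKC`
(`isPseudoResolventKC` + `norm_resolventKC_le_inv`). MODEL statement; not NS. [folklore] -/
theorem evans_taylor_remainderC (hL : 0 < L) (K : Esp L hL →L[ℝ] W L) (h : GardingDataKC L hL d V K D₀ D₁ V₀ c m)
    {σ ε : ℂ} (hσ : -m < σ.re) (hσε : -m < (σ + ε).re) (p : ℕ) (hv f : Wc L) :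
    ‖⟪hv, resolventKC hL K h (σ + ε) f⟫_ℂ
        - ∑ j ∈ Finset.range p, (-ε) ^ j * ⟪hv, (resolventKC hL K h σ ^ (j + 1)) f⟫_ℂ‖ ≤
      ‖ε‖ ^ p * ‖((ContinuousLinearMap.adjoint (resolventKC hL K h σ)) ^ p) hv‖ * ‖f‖ / (m + (σ + ε).re) := by
  have hJ := isPseudoResolventKC hL K h
  have key := hJ.norm_inner_apply_sub_sum_le_of_bound (z := σ) (w := σ + ε) hσ hσε p hv f
    (c := m + (σ + ε).re) (fun G => norm_resolventKC_le_inv hL K h hσε G)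
  have e : σ - (σ + ε) = -ε := by ring
  rw [e, norm_neg] at key
  exact key

/-- **(P7), far field, `GardingDataKC` version**: same statement as `evans_farField_remainder` for `R_K = resolventKC`.
MODEL statement; not NS. [folklore] -/
theorem evans_farField_remainderC (hL : 0 < L) (K : Esp L hL →L[ℝ] W L) (h : GardingDataKC L hL d V K D₀ D₁ V₀ c m)
    {z σ : ℂ} (hz : -m < z.re) (hσ : -m < σ.re) (hσ0 : σ ≠ 0) {n : ℕ} {f : ℕ → Wc L}
    (hchain : ∀ j < n, f j = resolventKC hL K h z (f (j + 1) + z • f j)) (hv : Wc L) :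
    ‖⟪hv, resolventKC hL K h σ (f 0)⟫_ℂ
        - ∑ j ∈ Finset.range n, ((-1) ^ j * σ⁻¹ ^ (j + 1)) * ⟪hv, f j⟫_ℂ‖ ≤
      ‖σ‖⁻¹ ^ n * ‖hv‖ * ‖f n‖ / (m + σ.re) :=
  (isPseudoResolventKC hL K h).norm_inner_apply_sub_sum_le_farField_of_bound hz hσ hσ0 hchain hv
    (fun G => norm_resolventKC_le_inv hL K h hσ G)

end KC

end SheetREvansTaylorModel
end Summit.NavierStokesRegularity.OSWSelfSimilar

end
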